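import Literature.NumberTheory.Transcendental.KZDilationBakerSectorComplexLifts
import Literature.NumberTheory.Transcendental.SemialgebraicAlgebraicPoints
import HarnessLib

/-!
# The Liouville sector of the dilation pencil, III: the logarithmic and argument lifts for loops

Loop versions of `KZDilationBakerSectorComplexLifts.lean` (route
`KontsevichZagierPeriods/LiftingCriteria`, crux `DilationLiftAtOne`).

* `exists_kernel_logPart'` — for Nash POSITIVE functions `M_k` on `(a,b) ⊇ [0,1]` with `M_k(0) = 1`
  and an exact relation `Σ_k e_k log M_k(1) = 0` (`e_k ∈ ℚ`), the dilation function of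
  `Σ_k e_k M_k'/(2M_k)` lies in `(ϖ − 1)·D'`: the generator `Q = Π_k M_k^{e_k/2}` is a Nash loop in
  `ℝ_{>0}` with `Q(0) = Q(1) = 1` and `Q'/Q` is the integrand (`KZ.dilationLogSector_lift`).
* `exists_kernel_argPart'` — for Nash loops `w_k` in the slit plane with an exact relation
  `Σ_k f_k (arg w_k(1) − arg w_k(0)) = 0` (`f_k ∈ ℚ`) and `θ_k' = (arg ∘ w_k)'`, the dilation
  function of `Σ_k f_k θ_k'` lies in `(ϖ − 1)·D'`: with integer multiples `F = D·f`, angle halving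
  gives a Nash `T` with `arctan T = (Σ F_k arg w_k)/2^{m+1}` (`exists_nash_arctan_eq_sum_arg`); two
  more halvings make `|T| < 1`; NEW for loops: `T(0) = T(1) =: τ₀` need not vanish, and the Möbius
  normalisation `T̃ = (T − τ₀)/(1 + τ₀T)` (`arctan T̃ = arctan T − arctan τ₀`, `Real.arctan_add`,
  legitimate as `|τ₀T| < 1`) has `T̃(0) = T̃(1) = 0` and the same `(arctan ∘ ·)'`, so the arctangent
  sector (`KZ.dilationArctanSector_lift`) applies.

Everything is proved; no `def`, no named fact.

## References
* M. Kontsevich, D. Zagier, *Periods* (2001), §1.2. [`KontsevichZagier2001`]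
-/

noncomputable section

open Set MeasureTheory Filter Complex
open scoped BigOperators Topology Real
open Literature.ModelTheory.ExponentialFields

namespace Literature.NumberTheory.Transcendental

namespace KZ.LiouvilleSector

open KZ.BakerSectorComplex KZ.DilationArctanSector

variable {a b : ℝ} {A : ℕ}

/-- **The logarithmic part, loop version.** See the module docstring.
[cite: KontsevichZagier2001, §1.2] -/
theorem exists_kernel_logPart' (ha : a < 0) (hb : 1 < b)
    (hI : IsSemialgebraic ℚ {t : Fin 1 → ℝ | t 0 ∈ Ioo a b}) {M M' : Fin A → ℝ → ℝ}
    (hMs : ∀ k, IsSemialgebraicFunOn ℚ {t : Fin 1 → ℝ | t 0 ∈ Ioo a b} (fun t => M k (t 0)))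
    (hMa : ∀ k, ∀ x ∈ Ioo a b, AnalyticAt ℝ (M k) x) (hMpos : ∀ k, ∀ x ∈ Ioo a b, 0 < M k x)
    (hMder : ∀ k, ∀ x ∈ Ioo a b, HasDerivAt (M k) (M' k x) x) (hM0 : ∀ k, M k 0 = 1)
    (e : Fin A → ℚ) (hrel : ∑ k, (e k : ℝ) * Real.log (M k 1) = 0) :
    ∃ (K : (Fin 2 → ℝ) → ℝ) (V : Set (Fin 2 → ℝ)), IsOpen V ∧
      (∀ ϖ ∈ Icc (0:ℝ) 1, ∀ x ∈ Set.pi Set.univ (fun _ : Fin 1 => Icc (0:ℝ) 1),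
        Matrix.vecCons ϖ x ∈ V) ∧
      IsSemialgebraicFunOn ℚ V K ∧ AnalyticOnNhd ℝ K V ∧
      ∀ ϖ ∈ Icc (0:ℝ) 1,
        (∫ z in Set.pi Set.univ (fun _ : Fin 1 => Icc (0:ℝ) 1),
            ∑ k, (e k : ℝ) * (M' k ((ϖ • z) 0) / (2 * M k ((ϖ • z) 0)))) =
          (ϖ - 1) * ∫ y in Set.pi Set.univ (fun _ : Fin 1 => Icc (0:ℝ) 1),
            K (Matrix.vecCons ϖ (ϖ • y)) := by
  have hb0 : (0:ℝ) < b := zero_lt_one.trans hb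
  have h0I : (0:ℝ) ∈ Ioo a b := ⟨ha, hb0⟩
  have h1I : (1:ℝ) ∈ Ioo a b := ⟨ha.trans zero_lt_one, hb⟩
  set N : Fin A → ℚ := fun k => e k / 2 with hN
  set Q : ℝ → ℝ := fun x => ∏ k, M k x ^ ((N k : ℚ) : ℝ) with hQ
  set h : ℝ → ℝ := fun x => ∑ k, (e k : ℝ) * (M' k x / (2 * M k x)) with hh
  have hQder : ∀ x ∈ Ioo a b, HasDerivAt Q (h x * Q x) x := by
    intro x hx
    have hd := KZ.DilationLogSector.hasDerivAt_nashProd hMpos hMder N hx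
    refine hd.congr_deriv ?_
    simp only [hQ]
    congr 1
    simp only [hh, hN]
    refine Finset.sum_congr rfl fun k _ => ?_
    have hm : M k x ≠ 0 := (hMpos k x hx).ne'
    push_cast
    field_simp
  have hQ01 : Q 1 = Q 0 := by
    have hQ0 : Q 0 = 1 := by
      refine KZ.DilationLogSector.nashProd_eq_one_of hMpos N h0I ?_
      simp [hM0]
    have hQ1 : Q 1 = 1 := by
      refine KZ.DilationLogSector.nashProd_eq_one_of hMpos N h1I ?_
      have : ∑ k, ((N k : ℚ) : ℝ) * Real.log (M k 1) = 2⁻¹ * ∑ k, (e k : ℝ) * Real.log (M k 1) := by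
        rw [Finset.mul_sum]
        refine Finset.sum_congr rfl fun k _ => ?_
        simp only [hN]
        push_cast
        ring
      rw [this, hrel, mul_zero]
    rw [hQ0, hQ1]
  obtain ⟨K, V, hVo, hVc, hKs, hKa, hid⟩ := KZ.dilationLogSector_lift ha hb
    (KZ.DilationLogSector.isSemialgebraicFunOn_nashProd hMpos hI hMs N)
    (fun x hx => KZ.DilationLogSector.analyticAt_nashProd hMpos hMa N hx)
    (fun x hx => KZ.DilationLogSector.nashProd_pos hMpos N hx) hQder hQ01
  exact ⟨K, V, hVo, hVc, hKs, hKa, fun ϖ hϖ => by simpa only [hh] using hid ϖ hϖ⟩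

/-- The halving map `t/(1 + √(1+t²))` has modulus `< 1`. [folklore] -/
theorem abs_halve_lt_one (t : ℝ) : |t / (1 + Real.sqrt (1 + t ^ 2))| < 1 := by
  have hs : |t| < Real.sqrt (1 + t ^ 2) := by
    rw [Real.lt_sqrt (abs_nonneg t), sq_abs]
    linarith
  have hpos : 0 < 1 + Real.sqrt (1 + t ^ 2) := by positivity
  rw [abs_div, abs_of_pos hpos, div_lt_one hpos]
  linarith [abs_nonneg t]

/-- **The argument part, loop version (with the Möbius normalisation).** See the module docstring.
[cite: KontsevichZagier2001, §1.2] -/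
theorem exists_kernel_argPart' (ha : a < 0) (hb : 1 < b)
    (hI : IsSemialgebraic ℚ {t : Fin 1 → ℝ | t 0 ∈ Ioo a b}) (w : Fin A → ℝ → ℂ)
    (hre : ∀ k, IsSemialgebraicFunOn ℚ {t : Fin 1 → ℝ | t 0 ∈ Ioo a b} (fun t => (w k (t 0)).re))
    (him : ∀ k, IsSemialgebraicFunOn ℚ {t : Fin 1 → ℝ | t 0 ∈ Ioo a b} (fun t => (w k (t 0)).im))
    (hrea : ∀ k, ∀ x ∈ Ioo a b, AnalyticAt ℝ (fun x => (w k x).re) x)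
    (hima : ∀ k, ∀ x ∈ Ioo a b, AnalyticAt ℝ (fun x => (w k x).im) x)
    (hslit : ∀ k, ∀ x ∈ Ioo a b, w k x ∈ slitPlane)
    {θ' : Fin A → ℝ → ℝ}
    (hθ : ∀ k, ∀ x ∈ Ioo a b, HasDerivAt (fun y => Complex.arg (w k y)) (θ' k x) x)
    (f : Fin A → ℚ)
    (hrel : ∑ k, (f k : ℝ) * (Complex.arg (w k 1) - Complex.arg (w k 0)) = 0) :
    ∃ (K : (Fin 2 → ℝ) → ℝ) (V : Set (Fin 2 → ℝ)), IsOpen V ∧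
      (∀ ϖ ∈ Icc (0:ℝ) 1, ∀ x ∈ Set.pi Set.univ (fun _ : Fin 1 => Icc (0:ℝ) 1),
        Matrix.vecCons ϖ x ∈ V) ∧
      IsSemialgebraicFunOn ℚ V K ∧ AnalyticOnNhd ℝ K V ∧
      ∀ ϖ ∈ Icc (0:ℝ) 1,
        (∫ z in Set.pi Set.univ (fun _ : Fin 1 => Icc (0:ℝ) 1),
            ∑ k, (f k : ℝ) * θ' k ((ϖ • z) 0)) =
          (ϖ - 1) * ∫ y in Set.pi Set.univ (fun _ : Fin 1 => Icc (0:ℝ) 1),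
            K (Matrix.vecCons ϖ (ϖ • y)) := by
  classical
  have hb0 : (0:ℝ) < b := zero_lt_one.trans hb
  have h0I : (0:ℝ) ∈ Ioo a b := ⟨ha, hb0⟩
  have h1I : (1:ℝ) ∈ Ioo a b := ⟨ha.trans zero_lt_one, hb⟩
  have hsub : Icc (0:ℝ) 1 ⊆ Ioo a b := fun x hx => ⟨ha.trans_le hx.1, hx.2.trans_lt hb⟩
  -- integer multiplicities
  obtain ⟨D, F, hD, hF⟩ := exists_int_mul_eq f
  have hD0 : (D : ℝ) ≠ 0 := by exact_mod_cast hD.ne'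
  -- angle halving: `arctan T = Θ/2^{m+1}`, `Θ = Σ F_k arg w_k`
  obtain ⟨m, T, hTs, hTa, hT⟩ := exists_nash_arctan_eq_sum_arg hI w hre him hrea hima hslit F
  -- two more halvings: `arctan T₂ = arctan T / 4`, `|T₂| < 1`
  set T₁ : ℝ → ℝ := fun x => T x / (1 + Real.sqrt (1 + T x ^ 2)) with hT₁
  set T₂ : ℝ → ℝ := fun x => T₁ x / (1 + Real.sqrt (1 + T₁ x ^ 2)) with hT₂
  have hT₁s : IsSemialgebraicFunOn ℚ {t : Fin 1 → ℝ | t 0 ∈ Ioo a b} (fun t => T₁ (t 0)) :=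
    isSemialgebraicFunOn_halve hI hTs
  have hT₂s : IsSemialgebraicFunOn ℚ {t : Fin 1 → ℝ | t 0 ∈ Ioo a b} (fun t => T₂ (t 0)) :=
    isSemialgebraicFunOn_halve hI hT₁s
  have hT₁a : ∀ x ∈ Ioo a b, AnalyticAt ℝ T₁ x := fun x hx => analyticAt_halve (hTa x hx)
  have hT₂a : ∀ x ∈ Ioo a b, AnalyticAt ℝ T₂ x := fun x hx => analyticAt_halve (hT₁a x hx)
  have hT₂arc : ∀ x, Real.arctan (T₂ x) = Real.arctan (T x) / 4 := by
    intro x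
    simp only [hT₂, hT₁]
    rw [arctan_halve, arctan_halve]
    ring
  have hT₂lt : ∀ x, |T₂ x| < 1 := fun x => abs_halve_lt_one _
  -- `T(1) = T(0)`, hence `T₂(1) = T₂(0) =: τ₀`
  have hΘ01 : ∑ k, (F k : ℝ) * Complex.arg (w k 1) = ∑ k, (F k : ℝ) * Complex.arg (w k 0) := by
    have h : ∑ k, (F k : ℝ) * (Complex.arg (w k 1) - Complex.arg (w k 0)) = 0 := by
      have : ∑ k, (F k : ℝ) * (Complex.arg (w k 1) - Complex.arg (w k 0)) =
          (D : ℝ) * ∑ k, (f k : ℝ) * (Complex.arg (w k 1) - Complex.arg (w k 0)) := by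
        rw [Finset.mul_sum]
        exact Finset.sum_congr rfl fun k _ => by rw [hF k]; ring
      rw [this, hrel, mul_zero]
    have h2 : ∑ k, (F k : ℝ) * (Complex.arg (w k 1) - Complex.arg (w k 0)) =
        ∑ k, (F k : ℝ) * Complex.arg (w k 1) - ∑ k, (F k : ℝ) * Complex.arg (w k 0) := by
      rw [← Finset.sum_sub_distrib]
      exact Finset.sum_congr rfl fun k _ => by ring
    rw [h2] at h
    linarith
  have hT01 : T 1 = T 0 := by
    apply Real.arctan_injective
    rw [hT 1 h1I, hT 0 h0I, hΘ01]
  set τ₀ : ℝ := T₂ 0 with hτ₀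
  have hT₂1 : T₂ 1 = τ₀ := by simp only [hτ₀, hT₂, hT₁, hT01]
  have hτ₀lt : |τ₀| < 1 := hT₂lt 0
  have hτ₀alg : IsAlgebraic ℚ τ₀ := hT₂s.isAlgebraic_apply_one h0I isAlgebraic_zero
  -- the Möbius normalisation `T̃ = (T₂ − τ₀)/(1 + τ₀ T₂)`
  have hprod : ∀ x, |τ₀ * T₂ x| < 1 := fun x => by
    rw [abs_mul]
    exact mul_lt_one_of_nonneg_of_lt_one_left (abs_nonneg _) hτ₀lt (hT₂lt x).le
  have hden : ∀ x, 0 < 1 + τ₀ * T₂ x := fun x => by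
    have := (abs_lt.mp (hprod x)).1
    linarith
  set Tt : ℝ → ℝ := fun x => (T₂ x - τ₀) / (1 + τ₀ * T₂ x) with hTt
  have hTts : IsSemialgebraicFunOn ℚ {t : Fin 1 → ℝ | t 0 ∈ Ioo a b} (fun t => Tt (t 0)) := by
    have hc : IsSemialgebraicFunOn ℚ {t : Fin 1 → ℝ | t 0 ∈ Ioo a b} (fun _ => τ₀) :=
      isSemialgebraicFunOn_const_of_isAlgebraic hI hτ₀alg
    have h1 : IsSemialgebraicFunOn ℚ {t : Fin 1 → ℝ | t 0 ∈ Ioo a b} (fun _ => (1:ℝ)) := by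
      simpa using isSemialgebraicFunOn_const_natCast hI 1
    exact (hT₂s.fun_sub hc).fun_mul ((h1.fun_add (hc.fun_mul hT₂s)).fun_inv)
  have hTta : ∀ x ∈ Ioo a b, AnalyticAt ℝ Tt x := fun x hx =>
    ((hT₂a x hx).sub analyticAt_const).div (analyticAt_const.add (analyticAt_const.mul (hT₂a x hx)))
      (hden x).ne'
  have hTt0 : Tt 0 = 0 := by simp [hTt, hτ₀]
  have hTt1 : Tt 1 = 0 := by simp [hTt, hT₂1]
  -- `arctan T̃ = arctan T₂ − arctan τ₀` on `ℝ`
  have hTtarc : ∀ x, Real.arctan (Tt x) = Real.arctan (T₂ x) - Real.arctan τ₀ := by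
    intro x
    have hlt : T₂ x * (-τ₀) < 1 := by
      have := (abs_lt.mp (hprod x)).1
      nlinarith
    have h := Real.arctan_add hlt
    rw [Real.arctan_neg] at h
    have heq : (T₂ x + -τ₀) / (1 - T₂ x * -τ₀) = Tt x := by
      simp only [hTt]
      congr 1
      ring
    rw [heq] at h
    linarith
  -- the derivative identity `ψ = (4·2^{m+1}/D) · (arctan T̃)'` on `(a,b)`
  set ψ : ℝ → ℝ := fun x => ∑ k, (f k : ℝ) * θ' k x with hψ
  have hψ_eq : ∀ x ∈ Ioo a b, ψ x = (4 * 2 ^ (m + 1) / (D : ℝ)) * (deriv Tt x / (1 + Tt x ^ 2)) := by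
    intro x hx
    -- derivative of `arctan ∘ T̃`
    have h1 : HasDerivAt (fun y => Real.arctan (Tt y)) (deriv Tt x / (1 + Tt x ^ 2)) x := by
      have h := ((hTta x hx).differentiableAt.hasDerivAt).arctan
      refine h.congr_deriv ?_
      ring
    -- derivative of `Θ/(4·2^{m+1}) − arctan τ₀`, `Θ = Σ F_k arg w_k`
    have h2 : HasDerivAt (fun y => (∑ k, (F k : ℝ) * Complex.arg (w k y)) / (4 * 2 ^ (m + 1)) -
        Real.arctan τ₀) ((∑ k, (F k : ℝ) * θ' k x) / (4 * 2 ^ (m + 1))) x := by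
      have hΘ : HasDerivAt (fun y => ∑ k, (F k : ℝ) * Complex.arg (w k y))
          (∑ k, (F k : ℝ) * θ' k x) x :=
        HasDerivAt.fun_sum fun k _ => (hθ k x hx).const_mul _
      exact (hΘ.div_const (4 * 2 ^ (m + 1))).sub_const (Real.arctan τ₀)
    -- the two functions agree near `x`
    have h3 : HasDerivAt (fun y => Real.arctan (Tt y))
        ((∑ k, (F k : ℝ) * θ' k x) / (4 * 2 ^ (m + 1))) x := by
      refine h2.congr_of_eventuallyEq ?_
      filter_upwards [Ioo_mem_nhds hx.1 hx.2] with y hy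
      rw [hTtarc, hT₂arc, hT y hy]
      ring
    have h4 := h1.unique h3
    have hsumF : ∑ k, (F k : ℝ) * θ' k x = (D : ℝ) * ψ x := by
      rw [hψ, Finset.mul_sum]
      exact Finset.sum_congr rfl fun k _ => by rw [hF k]; ring
    rw [h4, hsumF]
    have h2pow : (2 : ℝ) ^ (m + 1) ≠ 0 := by positivity
    field_simp
  -- the arctangent sector lift, rescaled
  obtain ⟨K, V, hVo, hVc, hKs, hKa, hid⟩ := KZ.dilationArctanSector_lift ha hb hTts hTta hTt0 hTt1
  have hcoef : IsAlgebraic ℚ (4 * 2 ^ (m + 1) / (D : ℝ)) := by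
    have : (4 * 2 ^ (m + 1) / (D : ℝ)) = ((4 * 2 ^ (m + 1) / D : ℚ) : ℝ) := by push_cast; ring
    rw [this]; exact isAlgebraic_algebraMap _
  have hVs : IsSemialgebraic ℚ V := IsSemialgebraicFunOn.isSemialgebraic_holds hKs
  refine ⟨fun p => (4 * 2 ^ (m + 1) / (D : ℝ)) * K p, V, hVo, hVc,
    (isSemialgebraicFunOn_const_of_isAlgebraic hVs hcoef).fun_mul hKs,
    fun p hp => analyticAt_const.mul (hKa p hp), fun ϖ hϖ => ?_⟩
  have hcong : (∫ z in Set.pi Set.univ (fun _ : Fin 1 => Icc (0:ℝ) 1), ψ ((ϖ • z) 0)) =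
      ∫ z in Set.pi Set.univ (fun _ : Fin 1 => Icc (0:ℝ) 1),
        (4 * 2 ^ (m + 1) / (D : ℝ)) * (deriv Tt ((ϖ • z) 0) / (1 + Tt ((ϖ • z) 0) ^ 2)) := by
    refine setIntegral_congr_fun (MeasurableSet.univ_pi fun _ => measurableSet_Icc) fun z hz => ?_
    have hz0 : z 0 ∈ Icc (0:ℝ) 1 := (Set.mem_univ_pi.mp hz) 0
    refine hψ_eq _ (hsub ⟨?_, ?_⟩)
    · simpa using mul_nonneg hϖ.1 hz0.1
    · simpa using mul_le_one₀ hϖ.2 hz0.1 hz0.2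
  calc (∫ z in Set.pi Set.univ (fun _ : Fin 1 => Icc (0:ℝ) 1), ∑ k, (f k : ℝ) * θ' k ((ϖ • z) 0))
        = ∫ z in Set.pi Set.univ (fun _ : Fin 1 => Icc (0:ℝ) 1), ψ ((ϖ • z) 0) := by
          simp only [hψ]
    _ = (4 * 2 ^ (m + 1) / (D : ℝ)) * ∫ z in Set.pi Set.univ (fun _ : Fin 1 => Icc (0:ℝ) 1),
          (deriv Tt ((ϖ • z) 0) / (1 + Tt ((ϖ • z) 0) ^ 2)) := by
          rw [hcong, MeasureTheory.integral_const_mul]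
    _ = (4 * 2 ^ (m + 1) / (D : ℝ)) * ((ϖ - 1) * ∫ y in Set.pi Set.univ (fun _ : Fin 1 => Icc (0:ℝ) 1),
          K (Matrix.vecCons ϖ (ϖ • y))) := by rw [hid ϖ hϖ]
    _ = (ϖ - 1) * ∫ y in Set.pi Set.univ (fun _ : Fin 1 => Icc (0:ℝ) 1),
          (4 * 2 ^ (m + 1) / (D : ℝ)) * K (Matrix.vecCons ϖ (ϖ • y)) := by
          rw [MeasureTheory.integral_const_mul]; ring

end KZ.LiouvilleSector

end Literature.NumberTheory.Transcendental
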